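import Summits.RiemannHypothesis.RiemannHypothesis.Theorems.ZetaStringSemilocalKernel
import Summits.RiemannHypothesis.RiemannHypothesis.Theorems.SemilocalKinkedWallOffsets
import Summits.RiemannHypothesis.RiemannHypothesis.Theorems.SemilocalCert554Threshold
import Summits.RiemannHypothesis.RiemannHypothesis.Theorems.SemilocalNegCert055747
import Summits.RiemannHypothesis.RiemannHypothesis.Theorems.HandoffLadderTheoremRungs
import HarnessLib

/-!
# The ET6 «necessity depth» rows as DBR-kernel theorems, adopted BY NAME from Column WEIL (RH-FREE; no recompute)

LINE 1 — LABEL: RH-FREE finite facts about explicit TRUNCATED forms: for single `q`, «the Kreĭn kernel of `Ψ_{primes<q}`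
is / is not positive semidefinite on configurations in `(0, ℓ)`» is Column WEIL's kernel theorem about `wallOffset q` /
`weilSemilocalThreshold S` RE-INDEXED through the dictionary `ZetaStringSemilocalKernel.isPosSemidefKernelOn_semilocalKernel_Ioo_zero_iff`;
the `∀ q` positivity statement is RH (`riemannHypothesis_iff_forall_semilocalKernel`) and is NOT claimed. bears_on: LADDER-RH
B-D (cell rh-dbr ENGINE-TARGETS §3.4 ET6 table; XCOL note rh-dbr-eng-6 g4; director-rh g6 BULLETIN #1 «adopt Column 2's
kernel theorems BY NAME»). WHAT THIS IS NOT: progress toward RH; not new certificates; «δ(q) ≥ 0» for `q ≤ 7` is an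
RH-FREE rung, NOT evidence for RH.

Notation of ENGINE-TARGETS §3.4: `ℓ*(P_<q)` = the one-sided positivity radius of the Kreĭn kernel of the screw function with
only the prime powers of primes `< q` kept (`Ψ_S`, `S = Nat.primesBelow q`, hypothesis `hΨ` as in `ZetaStringSemilocalKernel`);
`δ(q) = ℓ*(P_<q) − log q = 2·wallOffset q`. Rows (all RH-FREE, by transport):
* `q = 3`: holds on `(0, log 3)` (`wallOffset_three_nonneg`) and on `(0, 277/250)` (`SemilocalCert554.weilSemilocalPositivityOn_two_554`);
  ties for `ℓ > 97/87` (`SemilocalPolyWitness.weilSemilocalThreshold_two_le_055747`) — `δ(3) ∈ [0.0094, 0.0164]`;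
* `q = 5`: holds on `(0, log 5)` (`wallOffset_five_nonneg`); ties for `ℓ ≥ log 5 + 0.0126` (`wallOffset_five_mem_Ico_00063`);
* `q = 7`: holds on `(0, log 7)` (`wallOffset_seven_nonneg`); ties for `ℓ ≥ log 7 + 0.0141` (`wallOffset_seven_lt_000705`);
* `q = 11, 13`: ties for `ℓ ≥ log q + 0.01412 / 0.0132`; every prime `5 ≤ q ≤ 23`: ties for `ℓ ≥ log q + 0.0142`
  (`SemilocalKinkedWallOffsets.wallOffset_lt_00071_of_prime_le`) — the DBR reading «δ(q) < 0.0142».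
-/

-- `Summit.RiemannHypothesis.RiemannHypothesis.…` duplicates `RiemannHypothesis` BY DESIGN (D-0017).
set_option linter.dupNamespace false

noncomputable section

open MeasureTheory Set Filter
open scoped BigOperators

namespace Summit.RiemannHypothesis.RiemannHypothesis.Theorems.ZetaStringArchWall

open Literature.NumberTheory.LFunctions Literature.Analysis.Complex
open Summit.RiemannHypothesis.RiemannHypothesis.Theorems.MotivicDoor.SemilocalThreshold
open Summit.RiemannHypothesis.RiemannHypothesis.Theorems.HandoffMarginLaw (wallOffset wallOffset_nonneg_iff)
open Summit.RiemannHypothesis.RiemannHypothesis.Theorems.HandoffLadderTheoremRungs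
  (wallOffset_three_nonneg wallOffset_five_nonneg)
open Summit.RiemannHypothesis.RiemannHypothesis.Theorems.HandoffLadderRungOne (wallOffset_seven_nonneg)
open Summit.RiemannHypothesis.RiemannHypothesis.Theorems.SemilocalKinkedWallOffsets
open Summit.RiemannHypothesis.RiemannHypothesis.Theorems.SemilocalCert554 (weilSemilocalPositivityOn_two_554)
open Summit.RiemannHypothesis.RiemannHypothesis.Theorems.SemilocalPolyWitness (weilSemilocalThreshold_two_le_055747)

variable {q : ℕ} {Ψq : ℝ → ℝ} {S : Finset ℕ} {ΨS : ℝ → ℝ}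

/-! ## §1 Transport lemmas: `wallOffset q` ↔ one-sided windows of the truncated kernel -/

/-- **`ℓ*(P_<q) = log q + 2·wallOffset q`**: the truncated kernel holds on `(0, ℓ)` iff `ℓ ≤ log q + 2·wallOffset q`.
[cite: Yoshida1992HermitianForms, Prop. 6 (p. 320), with the primes restricted to S] -/
theorem isPosSemidefKernelOn_semilocalKernel_Ioo_zero_iff_le_wallOffset
    (hΨ : ∀ v, Ψq v = archScrew v -
      ∑ n ∈ Finset.Icc 1 ⌊Real.exp |v|⌋₊, weilSemilocalCoeff (Nat.primesBelow q) n * (|v| - Real.log n)) (l : ℝ) :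
    IsPosSemidefKernelOn (kreinKernel Ψq) (Ioo 0 l) ↔ l ≤ Real.log q + 2 * wallOffset q := by
  rw [isPosSemidefKernelOn_semilocalKernel_Ioo_zero_iff_le hΨ, wallOffset]
  constructor <;> intro h <;> linarith

/-- A certified SMALL wall offset is a DBR tie: if `wallOffset q < ε` then the truncated kernel is NOT positive
semidefinite on configurations in `(0, ℓ)` for every `ℓ ≥ log q + 2ε` («`δ(q) < 2ε`»). [cite: Yoshida1992HermitianForms, Prop. 6 (p. 320), with the primes restricted to S] -/
theorem not_isPosSemidefKernelOn_semilocalKernel_of_wallOffset_lt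
    (hΨ : ∀ v, Ψq v = archScrew v -
      ∑ n ∈ Finset.Icc 1 ⌊Real.exp |v|⌋₊, weilSemilocalCoeff (Nat.primesBelow q) n * (|v| - Real.log n))
    {ε l : ℝ} (hε : wallOffset q < ε) (hl : Real.log q + 2 * ε ≤ l) :
    ¬ IsPosSemidefKernelOn (kreinKernel Ψq) (Ioo 0 l) := by
  rw [isPosSemidefKernelOn_semilocalKernel_Ioo_zero_iff_le_wallOffset hΨ, not_le]
  linarith

/-- A non-negative wall offset is a DBR rung: the truncated kernel HOLDS on `(0, log q)` («`δ(q) ≥ 0`»).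
[cite: Yoshida1992HermitianForms, Prop. 6 (p. 320), with the primes restricted to S] -/
theorem isPosSemidefKernelOn_semilocalKernel_log_of_wallOffset_nonneg
    (hΨ : ∀ v, Ψq v = archScrew v -
      ∑ n ∈ Finset.Icc 1 ⌊Real.exp |v|⌋₊, weilSemilocalCoeff (Nat.primesBelow q) n * (|v| - Real.log n))
    (h : 0 ≤ wallOffset q) : IsPosSemidefKernelOn (kreinKernel Ψq) (Ioo 0 (Real.log q)) :=
  (wallOffset_nonneg_iff_semilocalKernel hΨ).1 h

/-! ## §2 Row `q = 3` (`S = {2}`): `δ(3) ∈ [0.0094, 0.0164]` in DBR clothing -/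

/-- RH-FREE rung: the `{2}`-truncated kernel (primes `< 3`) holds on `(0, log 3)` — `δ(3) ≥ 0`, Column WEIL's
`wallOffset_three_nonneg`. [cite: Yoshida1992, Thm 1 (p. 310), §6 (method)] -/
theorem isPosSemidefKernelOn_semilocalKernel_three_log
    (hΨ : ∀ v, Ψq v = archScrew v -
      ∑ n ∈ Finset.Icc 1 ⌊Real.exp |v|⌋₊, weilSemilocalCoeff (Nat.primesBelow 3) n * (|v| - Real.log n)) :
    IsPosSemidefKernelOn (kreinKernel Ψq) (Ioo 0 (Real.log 3)) :=
  isPosSemidefKernelOn_semilocalKernel_log_of_wallOffset_nonneg hΨ wallOffset_three_nonneg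

/-- RH-FREE: the `{2}`-truncated kernel holds on `(0, 277/250)` (`277/250 = 1.108 > log 3 = 1.0986`; Column WEIL's
kernel certificate `weilSemilocalPositivityOn_two_554`, transported). [cite: Yoshida1992, Thm 1 (p. 310), §6 (method)] -/
theorem isPosSemidefKernelOn_semilocalKernel_two_1108
    (hΨ : ∀ v, ΨS v = archScrew v -
      ∑ n ∈ Finset.Icc 1 ⌊Real.exp |v|⌋₊, weilSemilocalCoeff {2} n * (|v| - Real.log n)) :
    IsPosSemidefKernelOn (kreinKernel ΨS) (Ioo 0 ((277 : ℝ) / 250)) := by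
  rw [isPosSemidefKernelOn_semilocalKernel_Ioo_zero_iff hΨ]
  convert weilSemilocalPositivityOn_two_554 using 1
  norm_num

/-- RH-FREE tie: the `{2}`-truncated kernel is NOT positive semidefinite on configurations in `(0, ℓ)` for any
`ℓ > 97/87 = 1.11494…` (Column WEIL's `weilSemilocalThreshold_two_le_055747 : a*({2}) ≤ 97/174`, transported); so
`ℓ*({2}) ∈ [1.108, 97/87]`, `δ(3) ∈ [0.0094, 0.0164]`. [cite: Yoshida1992HermitianForms, Prop. 6 (p. 320), with the primes restricted to S] -/
theorem not_isPosSemidefKernelOn_semilocalKernel_two_of_gt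
    (hΨ : ∀ v, ΨS v = archScrew v -
      ∑ n ∈ Finset.Icc 1 ⌊Real.exp |v|⌋₊, weilSemilocalCoeff {2} n * (|v| - Real.log n))
    {l : ℝ} (hl : (97 : ℝ) / 87 < l) : ¬ IsPosSemidefKernelOn (kreinKernel ΨS) (Ioo 0 l) := by
  rw [isPosSemidefKernelOn_semilocalKernel_Ioo_zero_iff_le hΨ, not_le]
  have h := weilSemilocalThreshold_two_le_055747
  have e : (((97 / 174 : ℚ) : ℝ)) = 97 / 174 := by push_cast; ring
  rw [e] at h
  linarith

/-! ## §3 Rows `q = 5, 7` (`S = {2,3}`, `{2,3,5}`): rungs and kinked ties -/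

/-- RH-FREE rung: the `{2,3}`-truncated kernel holds on `(0, log 5)` — `δ(5) ≥ 0` (`wallOffset_five_nonneg`).
[cite: Yoshida1992, Thm 1 (p. 310), §6 (method)] -/
theorem isPosSemidefKernelOn_semilocalKernel_five_log
    (hΨ : ∀ v, Ψq v = archScrew v -
      ∑ n ∈ Finset.Icc 1 ⌊Real.exp |v|⌋₊, weilSemilocalCoeff (Nat.primesBelow 5) n * (|v| - Real.log n)) :
    IsPosSemidefKernelOn (kreinKernel Ψq) (Ioo 0 (Real.log 5)) :=
  isPosSemidefKernelOn_semilocalKernel_log_of_wallOffset_nonneg hΨ wallOffset_five_nonneg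

/-- RH-FREE tie: the `{2,3}`-truncated kernel fails inside `(0, ℓ)` for every `ℓ ≥ log 5 + 0.0126` — «`δ(5) < 0.0126`»
(Column WEIL's kinked kernel certificate `wallOffset_five_mem_Ico_00063`; certified two-engine value `δ(5) ≤ 0.00496`).
[cite: Yoshida1992HermitianForms, Prop. 6 (p. 320), with the primes restricted to S] -/
theorem not_isPosSemidefKernelOn_semilocalKernel_five
    (hΨ : ∀ v, Ψq v = archScrew v -
      ∑ n ∈ Finset.Icc 1 ⌊Real.exp |v|⌋₊, weilSemilocalCoeff (Nat.primesBelow 5) n * (|v| - Real.log n))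
    {l : ℝ} (hl : Real.log 5 + 0.0126 ≤ l) : ¬ IsPosSemidefKernelOn (kreinKernel Ψq) (Ioo 0 l) :=
  not_isPosSemidefKernelOn_semilocalKernel_of_wallOffset_lt hΨ wallOffset_five_mem_Ico_00063.2
    (by norm_num at hl ⊢; linarith)

/-- RH-FREE rung: the `{2,3,5}`-truncated kernel holds on `(0, log 7)` — `δ(7) ≥ 0` (`wallOffset_seven_nonneg`, from the
tree's full-form rung `WeilPositivityOn 1`). [cite: Yoshida1992, Thm 1 (p. 310), §6 (method)] -/
theorem isPosSemidefKernelOn_semilocalKernel_seven_log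
    (hΨ : ∀ v, Ψq v = archScrew v -
      ∑ n ∈ Finset.Icc 1 ⌊Real.exp |v|⌋₊, weilSemilocalCoeff (Nat.primesBelow 7) n * (|v| - Real.log n)) :
    IsPosSemidefKernelOn (kreinKernel Ψq) (Ioo 0 (Real.log 7)) :=
  isPosSemidefKernelOn_semilocalKernel_log_of_wallOffset_nonneg hΨ wallOffset_seven_nonneg

/-- RH-FREE tie: the `{2,3,5}`-truncated kernel fails inside `(0, ℓ)` for every `ℓ ≥ log 7 + 0.0141` — «`δ(7) < 0.0141`»
(`wallOffset_seven_lt_000705`; certified two-engine value `δ(7) ≤ 0.00250`). [cite: Yoshida1992HermitianForms, Prop. 6 (p. 320), with the primes restricted to S] -/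
theorem not_isPosSemidefKernelOn_semilocalKernel_seven
    (hΨ : ∀ v, Ψq v = archScrew v -
      ∑ n ∈ Finset.Icc 1 ⌊Real.exp |v|⌋₊, weilSemilocalCoeff (Nat.primesBelow 7) n * (|v| - Real.log n))
    {l : ℝ} (hl : Real.log 7 + 0.0141 ≤ l) : ¬ IsPosSemidefKernelOn (kreinKernel Ψq) (Ioo 0 l) :=
  not_isPosSemidefKernelOn_semilocalKernel_of_wallOffset_lt hΨ wallOffset_seven_lt_000705
    (by norm_num at hl ⊢; linarith)

/-! ## §4 Rows `q = 11, 13` and every prime `5 ≤ q ≤ 23`: kinked ties -/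

/-- RH-FREE tie, row `q = 11`: «`δ(11) < 0.01412`» (`wallOffset_eleven_lt_000706`; certified `≤ 0.00104`).
[cite: Yoshida1992HermitianForms, Prop. 6 (p. 320), with the primes restricted to S] -/
theorem not_isPosSemidefKernelOn_semilocalKernel_eleven
    (hΨ : ∀ v, Ψq v = archScrew v -
      ∑ n ∈ Finset.Icc 1 ⌊Real.exp |v|⌋₊, weilSemilocalCoeff (Nat.primesBelow 11) n * (|v| - Real.log n))
    {l : ℝ} (hl : Real.log 11 + 0.01412 ≤ l) : ¬ IsPosSemidefKernelOn (kreinKernel Ψq) (Ioo 0 l) :=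
  not_isPosSemidefKernelOn_semilocalKernel_of_wallOffset_lt hΨ wallOffset_eleven_lt_000706
    (by norm_num at hl ⊢; linarith)

/-- RH-FREE tie, row `q = 13`: «`δ(13) < 0.0132`» (`wallOffset_thirteen_lt_00066`; certified `≤ 0.00076`).
[cite: Yoshida1992HermitianForms, Prop. 6 (p. 320), with the primes restricted to S] -/
theorem not_isPosSemidefKernelOn_semilocalKernel_thirteen
    (hΨ : ∀ v, Ψq v = archScrew v -
      ∑ n ∈ Finset.Icc 1 ⌊Real.exp |v|⌋₊, weilSemilocalCoeff (Nat.primesBelow 13) n * (|v| - Real.log n))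
    {l : ℝ} (hl : Real.log 13 + 0.0132 ≤ l) : ¬ IsPosSemidefKernelOn (kreinKernel Ψq) (Ioo 0 l) :=
  not_isPosSemidefKernelOn_semilocalKernel_of_wallOffset_lt hΨ wallOffset_thirteen_lt_00066
    (by norm_num at hl ⊢; linarith)

/-- **RH-FREE uniform tie for the primes `5 ≤ q ≤ 23`**: the truncated kernel of `Ψ_{primes<q}` is NOT positive
semidefinite on configurations in `(0, ℓ)` for any `ℓ ≥ log q + 0.0142` — the DBR reading «`δ(q) < 0.0142` for every prime
`5 ≤ q ≤ 23`» of Column WEIL's kinked wall table `wallOffset_lt_00071_of_prime_le` (certified two-engine values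
`δ(q) ≤ 0.00496, 0.00250, 0.00104, 0.00076, 0.00046, 0.00038, 0.00027` for `q = 5, 7, 11, 13, 17, 19, 23`).
[cite: Yoshida1992HermitianForms, Prop. 6 (p. 320), with the primes restricted to S] -/
theorem not_isPosSemidefKernelOn_semilocalKernel_of_prime_le (hq : q.Prime) (h5 : 5 ≤ q) (h23 : q ≤ 23)
    (hΨ : ∀ v, Ψq v = archScrew v -
      ∑ n ∈ Finset.Icc 1 ⌊Real.exp |v|⌋₊, weilSemilocalCoeff (Nat.primesBelow q) n * (|v| - Real.log n))
    {l : ℝ} (hl : Real.log q + 0.0142 ≤ l) : ¬ IsPosSemidefKernelOn (kreinKernel Ψq) (Ioo 0 l) :=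
  not_isPosSemidefKernelOn_semilocalKernel_of_wallOffset_lt hΨ (wallOffset_lt_00071_of_prime_le hq h5 h23)
    (by norm_num at hl ⊢; linarith)

end Summit.RiemannHypothesis.RiemannHypothesis.Theorems.ZetaStringArchWall

end
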